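import Mathlib.Algebra.Lie.Engel
import Literature.NumberTheory.Automorphic.LieAlgebraGLNilpotentExp
import Literature.NumberTheory.Automorphic.RootSubgroupProofs
import Literature.NumberTheory.Automorphic.ZariskiGLGeneration
import HarnessLib

/-!
# A reductive group has no `Ad`-stable Lie algebra of nilpotent matrices (characteristic `0`)
(trunk T-AUTOMORPHIC, G25 AutomorphicL)

Companion to `LieAlgebraGLNilpotentExp.lean` (the exponential theorem `expHom_mem_of_mem_lieAlgebraGL`:
`exp (x A) ∈ G` for nilpotent `A ∈ Lie(G)`, characteristic `0`; `NilpotentExpRootHom.lean`'s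
one-parameter groups `expHom A`), `RootSubgroupProofs.lean` (images of root homomorphisms are
closed and connected) and `ZariskiGLGeneration.lean` (Springer 2.2.7 (i): groups generated by
closed connected subgroups are closed and connected), namespace `Literature.NumberTheory.Automorphic`.
This is how the hypothesis "`G` is reductive" (`IsReductiveSubgroup`: no non-trivial connected
normal unipotent subgroup) is brought to bear on the Lie algebra in characteristic `0`:

* `expSubgroup 𝔫 hnil = U(𝔫) = ⟨exp (x A) | A ∈ 𝔫⟩`; `expSubgroup_le` (`U(𝔫) ≤ G` when
  `𝔫 ⊆ Lie(G)`), `conj_mem_expSubgroup` (normalised by every `g` with `g 𝔫 g⁻¹ ⊆ 𝔫`),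
  `isZConnected_range_expHom` (each `exp (k A)` is connected — a root homomorphism for the trivial
  torus), **`isZConnected_expSubgroup`**;
* `endLieSubalgebra 𝔫` (a bracket-closed `𝔫 ⊆ 𝔤𝔩ₙ` as a Mathlib `LieSubalgebra` of
  `End(kⁿ)`), **`exists_flag_of_forall_isNilpotent`** (Engel, Mathlib
  `LieModule.isNilpotent_iff_forall'`: a Lie algebra of nilpotent matrices strictly lowers a flag),
  `LowersFlag` with `lowersFlag_exp`, `LowersFlag.mul`, `LowersFlag.isUnipotent`, whence
  **`isUnipotentSubgroup_expSubgroup`**;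
* **`eq_bot_of_adStable_of_forall_isNilpotent`** — for `G` reductive over an algebraically closed
  field of characteristic `0`, an `Ad(G)`-stable bracket-closed subspace `𝔫 ⊆ Lie(G)` of nilpotent
  matrices is zero (`U(𝔫)` is a connected normal unipotent subgroup of `G`, hence trivial, and
  `exp (x A) = 1` for all `x` forces `A = 0` by the retraction `exists_retraction_expHom`).

Consumer: `LieCentralizerTorus.lean` (`𝔤^T = Lie(T)`).

## Mathlib

`LieSubalgebra`, `LieModule.isNilpotent_iff_forall'` (Engel), `LieModule.lowerCentralSeries`,
`LieSubalgebra.toEnd_eq`, `LieModule.toEnd_module_end`, `Subgroup.iSup_induction`. Mathlib has no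
algebraic groups; nothing here duplicates a Mathlib or Literature declaration (searched `expSubgroup`,
`LowersFlag`, `unipotent radical`).

## References

* T. A. Springer, *Linear Algebraic Groups*, 2nd ed., Progress in Mathematics 9, Birkhäuser
  (1998), 2.2.7 (i), 2.4, 6.4.14 (reductive), 7.3.1 [SpringerLAG1998].
* A. Borel, *Linear Algebraic Groups*, 2nd ed., GTM 126, Springer (1991), II §7, IV.11.21.
-/

noncomputable section

/-! The commutator bracket on `Module.End k V` (Mathlib's reducible non-instance, activated locally
as in `Mathlib.Algebra.Lie.OfAssociative`). -/
attribute [local instance 100] LieRing.ofAssociativeRing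

open MvPolynomial

namespace Literature.NumberTheory.Automorphic

variable {k : Type*} [Field k] {n : Type*} [Fintype n] [DecidableEq n]

/-! ### The group generated by the exponentials of a space of nilpotent matrices -/

section ExpGroup

variable [CharZero k]

/-- The subgroup `U(𝔫) = ⟨exp (x A) | A ∈ 𝔫, x ∈ k⟩` of `GL n k` generated by the exponentials of
a set `𝔫` of nilpotent matrices. [folklore] -/
def expSubgroup (𝔫 : Set (Matrix n n k)) (hnil : ∀ A ∈ 𝔫, IsNilpotent A) : Subgroup (GL n k) :=
  ⨆ A : ↥𝔫, (expHom A.1 (hnil A.1 A.2)).range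

variable {𝔫 : Set (Matrix n n k)} {hnil : ∀ A ∈ 𝔫, IsNilpotent A}

/-- The generators `exp (x A)` lie in `U(𝔫)`. [folklore] -/
lemma expHom_mem_expSubgroup {A : Matrix n n k} (hA : A ∈ 𝔫) (x : Multiplicative k) :
    expHom A (hnil A hA) x ∈ expSubgroup 𝔫 hnil :=
  Subgroup.mem_iSup_of_mem (⟨A, hA⟩ : ↥𝔫) ⟨x, rfl⟩

/-- **`U(𝔫) ≤ G` if `𝔫 ⊆ Lie(G)`** (`G` algebraic, characteristic `0`): the exponential theorem
`expHom_mem_of_mem_lieAlgebraGL`. [folklore] -/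
theorem expSubgroup_le {G : Subgroup (GL n k)} (hG : IsAlgebraicSubgroup G)
    (h𝔫 : 𝔫 ⊆ (lieAlgebraGL G : Set (Matrix n n k))) : expSubgroup 𝔫 hnil ≤ G :=
  iSup_le fun A => by
    rintro _ ⟨x, rfl⟩
    exact expHom_mem_of_mem_lieAlgebraGL hG (h𝔫 A.2) _ x

/-- Conjugating a generator: `g exp(x A) g⁻¹ = exp (x g A g⁻¹)`. [folklore] -/
lemma conj_expHom {A : Matrix n n k} (hA : IsNilpotent A) (g : GL n k) (x : Multiplicative k)
    (hA' : IsNilpotent ((g : Matrix n n k) * A * ((g⁻¹ : GL n k) : Matrix n n k))) :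
    g * expHom A hA x * g⁻¹ =
      expHom ((g : Matrix n n k) * A * ((g⁻¹ : GL n k) : Matrix n n k)) hA' x := by
  apply Units.ext
  simp only [Units.val_mul, coe_expHom_apply]
  exact conj_exp_smul hA g x.toAdd

/-- **`U(𝔫)` is normalised by every `g` with `g 𝔫 g⁻¹ ⊆ 𝔫`.** [folklore] -/
theorem conj_mem_expSubgroup {g : GL n k}
    (hg : ∀ A ∈ 𝔫, (g : Matrix n n k) * A * ((g⁻¹ : GL n k) : Matrix n n k) ∈ 𝔫)
    {u : GL n k} (hu : u ∈ expSubgroup 𝔫 hnil) : g * u * g⁻¹ ∈ expSubgroup 𝔫 hnil := by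
  refine Subgroup.iSup_induction (C := fun u => g * u * g⁻¹ ∈ expSubgroup 𝔫 hnil) _ hu ?_ ?_ ?_
  · rintro A _ ⟨x, rfl⟩
    rw [conj_expHom _ g x (hnil _ (hg A.1 A.2))]
    exact expHom_mem_expSubgroup (hg A.1 A.2) x
  · rw [mul_one, mul_inv_cancel]
    exact (expSubgroup 𝔫 hnil).one_mem
  · intro u v hu hv
    have e : g * (u * v) * g⁻¹ = (g * u * g⁻¹) * (g * v * g⁻¹) := by group
    rw [e]
    exact (expSubgroup 𝔫 hnil).mul_mem hu hv

/-- The image of `x ↦ exp (x A)` is Zariski-connected (for `A ≠ 0` it is a root homomorphism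
relative to the trivial torus, `isRootHom_codRestrict_expHom`, hence has a connected closed image,
`IsRootHom.isZConnected_map_range`; for `A = 0` it is trivial). [folklore] -/
theorem isZConnected_range_expHom {G : Subgroup (GL n k)} (hG : IsAlgebraicSubgroup G)
    {A : Matrix n n k} (hA : IsNilpotent A) (hAG : ∀ x, expHom A hA x ∈ G) :
    IsZConnected (expHom A hA).range := by
  haveI : Infinite k := Infinite.of_injective _ (Nat.cast_injective (R := k))
  by_cases hA0 : A = 0
  · have h : (expHom A hA).range = ⊥ := by
      rw [Subgroup.eq_bot_iff_forall]
      rintro _ ⟨x, rfl⟩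
      apply Units.ext
      simp [hA0]
    rw [h]
    exact isZConnected_bot
  · have hu := isRootHom_codRestrict_expHom (T := ⊥) (G := G) bot_le hA hA0 hAG (α := 1)
      (fun t => by
        have ht : (t : GL n k) = 1 := Subgroup.mem_bot.1 t.2
        simp [ht])
    have h := hu.isZConnected_map_range hG
    have hr : ((expHom A hA).codRestrict G hAG).range.map G.subtype = (expHom A hA).range := by
      ext g
      constructor
      · rintro ⟨_, ⟨x, rfl⟩, rfl⟩; exact ⟨x, rfl⟩
      · rintro ⟨x, rfl⟩; exact ⟨_, ⟨x, rfl⟩, rfl⟩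
    rwa [hr] at h

/-- **`U(𝔫)` is Zariski-connected** when `𝔫 ⊆ Lie(G)` for an algebraic `G` (over an
algebraically closed field of characteristic `0`): it is generated by the connected closed
subgroups `exp (k A)` (Springer 2.2.7 (i), `isZConnected_iSup`). [cite: SpringerLAG1998, 2.2.7 (i)] -/
theorem isZConnected_expSubgroup [IsAlgClosed k] {G : Subgroup (GL n k)} (hG : IsAlgebraicSubgroup G)
    (h𝔫 : 𝔫 ⊆ (lieAlgebraGL G : Set (Matrix n n k))) : IsZConnected (expSubgroup 𝔫 hnil) :=
  isZConnected_iSup _ fun A => isZConnected_range_expHom hG _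
    (fun x => expHom_mem_of_mem_lieAlgebraGL hG (h𝔫 A.2) _ x)

end ExpGroup

/-! ### A Lie algebra of nilpotent matrices exponentiates to a unipotent group (Engel) -/

section Engel

variable [CharZero k]

/-- The image in `End(kⁿ)` of a bracket-closed subspace `𝔫 ⊆ 𝔤𝔩ₙ`, as a Lie subalgebra of
`Module.End k (n → k)` (commutator bracket). [folklore] -/
def endLieSubalgebra (𝔫 : Submodule k (Matrix n n k))
    (hlie : ∀ A ∈ 𝔫, ∀ B ∈ 𝔫, A * B - B * A ∈ 𝔫) : LieSubalgebra k (Module.End k (n → k)) :=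
  { 𝔫.map (Matrix.toLin' : Matrix n n k ≃ₗ[k] Module.End k (n → k)).toLinearMap with
    lie_mem' := by
      rintro _ _ ⟨A, hA, rfl⟩ ⟨B, hB, rfl⟩
      refine ⟨A * B - B * A, hlie A hA B hB, ?_⟩
      simp only [LinearEquiv.coe_coe, map_sub, Matrix.toLin'_mul]
      rfl }

variable {𝔫 : Submodule k (Matrix n n k)}

omit [CharZero k] in
/-- `toLin' A ∈ endLieSubalgebra 𝔫` for `A ∈ 𝔫`. [folklore] -/
lemma toLin'_mem_endLieSubalgebra {hlie : ∀ A ∈ 𝔫, ∀ B ∈ 𝔫, A * B - B * A ∈ 𝔫} {A : Matrix n n k}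
    (hA : A ∈ 𝔫) : Matrix.toLin' A ∈ endLieSubalgebra 𝔫 hlie := ⟨A, hA, rfl⟩

omit [CharZero k] in
/-- **Engel: a Lie algebra of nilpotent matrices has a flag it strictly lowers.** If every
element of the bracket-closed subspace `𝔫` is nilpotent, the standard module `kⁿ` is a nilpotent
module for `𝔫` (Mathlib's Engel theorem `LieModule.isNilpotent_iff_forall'`), so its lower central
series `kⁿ = C₀ ⊇ C₁ ⊇ ⋯ ⊇ C_m = 0` has `A Cᵢ ⊆ C_{i+1}` for `A ∈ 𝔫`. [folklore] -/
theorem exists_flag_of_forall_isNilpotent (hlie : ∀ A ∈ 𝔫, ∀ B ∈ 𝔫, A * B - B * A ∈ 𝔫)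
    (hnil : ∀ A ∈ 𝔫, IsNilpotent A) :
    ∃ (m : ℕ) (C : ℕ → Submodule k (n → k)), C 0 = ⊤ ∧ C m = ⊥ ∧ Antitone C ∧
      ∀ i, ∀ A ∈ 𝔫, ∀ v ∈ C i, A.mulVec v ∈ C (i + 1) := by
  set L := endLieSubalgebra 𝔫 hlie with hL
  have hEngel : LieModule.IsNilpotent (↥L) (n → k) := by
    refine (LieModule.isNilpotent_iff_forall' (R := k)).2 fun x => ?_
    obtain ⟨A, hA, hAx⟩ := x.2
    rw [LieSubalgebra.toEnd_eq, LieModule.toEnd_module_end, LieHom.id_apply, ← hAx]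
    change IsNilpotent (Matrix.toLin' A)
    exact (Matrix.isNilpotent_toLin'_iff A).2 (hnil A hA)
  obtain ⟨m, hm⟩ := (LieModule.isNilpotent_iff k (↥L) (n → k)).1 hEngel
  refine ⟨m, fun i => (LieModule.lowerCentralSeries k (↥L) (n → k) i : Submodule k (n → k)),
    ?_, ?_, ?_, ?_⟩
  · dsimp only
    rw [LieModule.lowerCentralSeries_zero]; rfl
  · dsimp only
    rw [hm]; rfl
  · intro i j hij
    exact (LieSubmodule.toSubmodule_le_toSubmodule _ _).2 (LieModule.antitone_lowerCentralSeries k _ _ hij)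
  · intro i A hA v hv
    have hx : (⟨Matrix.toLin' A, toLin'_mem_endLieSubalgebra (hlie := hlie) hA⟩ : ↥L) ∈
        (⊤ : LieIdeal k ↥L) := trivial
    have h := LieSubmodule.lie_mem_lie hx hv
    rw [← LieModule.lowerCentralSeries_succ] at h
    have hbr : ⁅(⟨Matrix.toLin' A, toLin'_mem_endLieSubalgebra (hlie := hlie) hA⟩ : ↥L), v⁆ =
        A.mulVec v := by
      rw [LieSubalgebra.coe_bracket_of_module]
      change Matrix.toLin' A v = A.mulVec v
      rw [Matrix.toLin'_apply]
    rw [hbr] at h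
    exact h

/-- A matrix `g` *strictly lowers* the flag `C` if `(g - 1) Cᵢ ⊆ C_{i+1}` for all `i`. [folklore] -/
def LowersFlag (C : ℕ → Submodule k (n → k)) (g : Matrix n n k) : Prop :=
  ∀ i, ∀ v ∈ C i, g.mulVec v - v ∈ C (i + 1)

variable {C : ℕ → Submodule k (n → k)}

omit [CharZero k] in
/-- `1` lowers every flag. [folklore] -/
lemma lowersFlag_one : LowersFlag C (1 : Matrix n n k) := fun i v _ => by
  rw [Matrix.one_mulVec, sub_self]; exact (C (i + 1)).zero_mem

omit [CharZero k] [DecidableEq n] in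
/-- Matrices lowering an antitone flag are closed under products:
`g h v - v = (g (h v - v) - (h v - v)) + (h v - v) + (g v - v)`. [folklore] -/
lemma LowersFlag.mul (hC : Antitone C) {g h : Matrix n n k} (hg : LowersFlag C g) (hh : LowersFlag C h) :
    LowersFlag C (g * h) := by
  intro i v hv
  have h1 : h.mulVec v - v ∈ C (i + 1) := hh i v hv
  have h2 : g.mulVec (h.mulVec v - v) - (h.mulVec v - v) ∈ C (i + 1) :=
    hC (Nat.le_succ _) (hg (i + 1) _ h1)
  have h3 : g.mulVec v - v ∈ C (i + 1) := hg i v hv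
  have e : (g * h).mulVec v - v =
      (g.mulVec (h.mulVec v - v) - (h.mulVec v - v)) + (h.mulVec v - v) + (g.mulVec v - v) := by
    rw [← Matrix.mulVec_mulVec, Matrix.mulVec_sub]; abel
  rw [e]
  exact (C (i + 1)).add_mem ((C (i + 1)).add_mem h2 h1) h3

omit [CharZero k] in
/-- Powers of a matrix mapping each `Cᵢ` into `C_{i+1}` map `Cᵢ` into `C_{i+j}`. [folklore] -/
lemma pow_mulVec_mem {A : Matrix n n k} (hA : ∀ i, ∀ v ∈ C i, A.mulVec v ∈ C (i + 1)) (j i : ℕ)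
    {v : n → k} (hv : v ∈ C i) : (A ^ j).mulVec v ∈ C (i + j) := by
  induction j generalizing i v with
  | zero => rwa [pow_zero, Matrix.one_mulVec, add_zero]
  | succ j ih =>
    rw [pow_succ, ← Matrix.mulVec_mulVec, add_comm j 1, ← add_assoc]
    exact ih (i + 1) (hA i v hv)

/-- **`exp (x A)` lowers the flag** when `A` maps each `Cᵢ` into `C_{i+1}`:
`exp (x A) v - v = ∑_{j ≥ 1} xʲ Aʲ v / j! ∈ C_{i+1}`. [folklore] -/
lemma lowersFlag_exp (hC : Antitone C) {A : Matrix n n k} (hAnil : IsNilpotent A)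
    (hA : ∀ i, ∀ v ∈ C i, A.mulVec v ∈ C (i + 1)) (x : k) :
    LowersFlag C (IsNilpotent.exp (x • A)) := by
  obtain ⟨N, hN⟩ := hAnil
  intro i v hv
  rw [exp_smul_matrix_eq_sum (N := N + 1) (by rw [pow_succ, hN, zero_mul]) x,
    Finset.sum_range_succ', pow_zero, pow_zero, one_smul, Nat.factorial_zero, Nat.cast_one, inv_one,
    one_smul, Matrix.add_mulVec, Matrix.one_mulVec, add_sub_cancel_right, Matrix.sum_mulVec]
  refine (C (i + 1)).sum_mem fun j _ => ?_
  rw [Matrix.smul_mulVec, Matrix.smul_mulVec]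
  refine (C (i + 1)).smul_mem _ ((C (i + 1)).smul_mem _ ?_)
  exact hC (by omega) (pow_mulVec_mem hA (j + 1) i hv)

omit [CharZero k] in
/-- A matrix lowering a flag with `C₀ = kⁿ`, `C_m = 0` is unipotent: `(g - 1)^m = 0`. [folklore] -/
lemma LowersFlag.isUnipotent (h0 : C 0 = ⊤) {m : ℕ} (hm : C m = ⊥) {g : Matrix n n k}
    (hg : LowersFlag C g) : IsNilpotent (g - 1) := by
  have hpow : ∀ (j : ℕ) (v : n → k), ((g - 1) ^ j).mulVec v ∈ C j := by
    intro j
    induction j with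
    | zero => intro v; rw [h0]; exact Submodule.mem_top
    | succ j ih =>
      intro v
      rw [pow_succ', ← Matrix.mulVec_mulVec, Matrix.sub_mulVec, Matrix.one_mulVec]
      exact hg j _ (ih v)
  refine ⟨m, ?_⟩
  have h : Matrix.toLin' ((g - 1) ^ m) = 0 := by
    refine LinearMap.ext fun v => ?_
    rw [Matrix.toLin'_apply, LinearMap.zero_apply]
    have hv := hpow m v
    rwa [hm, Submodule.mem_bot] at hv
  exact Matrix.toLin'.injective (by rw [h, map_zero])

end Engel

/-! ### The theorem -/

section Reductive

variable [IsAlgClosed k] [CharZero k] {G : Subgroup (GL n k)}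

omit [IsAlgClosed k] in
/-- **`U(𝔫)` is unipotent** for a bracket-closed subspace `𝔫` of nilpotent matrices: every element
of the group generated by the `exp (x A)`, `A ∈ 𝔫`, strictly lowers the Engel flag of `𝔫`
(`exists_flag_of_forall_isNilpotent`, `lowersFlag_exp`, `LowersFlag.mul`), hence is unipotent.
[folklore] -/
theorem isUnipotentSubgroup_expSubgroup {𝔫 : Submodule k (Matrix n n k)}
    (hlie : ∀ A ∈ 𝔫, ∀ B ∈ 𝔫, A * B - B * A ∈ 𝔫) (hnil : ∀ A ∈ 𝔫, IsNilpotent A) :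
    IsUnipotentSubgroup (expSubgroup (𝔫 : Set (Matrix n n k)) hnil) := by
  obtain ⟨m, C, h0, hm, hC, hA⟩ := exists_flag_of_forall_isNilpotent hlie hnil
  intro u hu
  have hlow : LowersFlag C (u : Matrix n n k) := by
    refine Subgroup.iSup_induction (C := fun u : GL n k => LowersFlag C (u : Matrix n n k)) _ hu
      ?_ ?_ ?_
    · rintro A _ ⟨x, rfl⟩
      rw [coe_expHom_apply]
      exact lowersFlag_exp hC (hnil A.1 A.2) (fun i v hv => hA i A.1 A.2 v hv) _
    · exact lowersFlag_one
    · intro u v hu hv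
      rw [Units.val_mul]
      exact hu.mul hC hv
  exact hlow.isUnipotent h0 hm

/-- **A reductive group contains no non-zero `Ad(G)`-stable Lie algebra of nilpotent matrices in
its Lie algebra** (over an algebraically closed field of characteristic `0`). Let `G ≤ GL n k` be
reductive (`IsReductiveSubgroup`: algebraic, with no non-trivial Zariski-connected normal unipotent
subgroup) and `𝔫 ⊆ Lie(G)` a subspace of nilpotent matrices, closed under the commutator and
stable under `Ad(g)`, `g ∈ G`. Then `𝔫 = 0`. Proof: the group `U(𝔫)` generated by the
`exp (x A)`, `A ∈ 𝔫`, lies in `G` (`expSubgroup_le`, the exponential theorem), is normal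
(`conj_mem_expSubgroup`), Zariski-connected (`isZConnected_expSubgroup`, Springer 2.2.7 (i)) and
unipotent (`isUnipotentSubgroup_expSubgroup`, Engel), hence trivial; so `exp (x A) = 1` for all
`x`, which forces `A = 0` (the retraction `exists_retraction_expHom`). This is how "`R_u(G) = 1`"
is used at the level of the Lie algebra (cf. Borel, *Linear Algebraic Groups*, II §7 and IV.11.21;
Humphreys §13, §19.5). [folklore] -/
theorem eq_bot_of_adStable_of_forall_isNilpotent (hG : IsReductiveSubgroup G)
    {𝔫 : Submodule k (Matrix n n k)} (h𝔫G : 𝔫 ≤ lieAlgebraGL G)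
    (hAd : ∀ g ∈ G, ∀ A ∈ 𝔫, (g : Matrix n n k) * A * ((g⁻¹ : GL n k) : Matrix n n k) ∈ 𝔫)
    (hlie : ∀ A ∈ 𝔫, ∀ B ∈ 𝔫, A * B - B * A ∈ 𝔫) (hnil : ∀ A ∈ 𝔫, IsNilpotent A) : 𝔫 = ⊥ := by
  set U := expSubgroup (𝔫 : Set (Matrix n n k)) hnil with hU
  have hUG : U ≤ G := expSubgroup_le hG.1 h𝔫G
  have hnormal : (U.subgroupOf G).Normal := by
    refine ⟨fun u hu g => ?_⟩
    rw [Subgroup.mem_subgroupOf] at hu ⊢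
    simp only [Subgroup.coe_mul, Subgroup.coe_inv]
    exact conj_mem_expSubgroup (hAd g g.2) hu
  have hconn : IsZConnected U := isZConnected_expSubgroup hG.1 h𝔫G
  have hunip : IsUnipotentSubgroup U := isUnipotentSubgroup_expSubgroup hlie hnil
  have hbot : U = ⊥ := hG.2 U hUG hnormal hconn hunip
  rw [Submodule.eq_bot_iff]
  intro A hA
  by_contra hA0
  obtain ⟨q, hq⟩ := exists_retraction_expHom (hnil A hA) hA0
  have h1 : ∀ x : k, expHom A (hnil A hA) (Multiplicative.ofAdd x) = 1 := fun x => by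
    rw [← Subgroup.mem_bot, ← hbot]
    exact expHom_mem_expSubgroup hA _
  have h01 : (0 : k) = 1 := by
    rw [← hq 0, ← hq 1, h1, h1]
  exact zero_ne_one h01

end Reductive

end Literature.NumberTheory.Automorphic
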